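import Summits.Ventures.PercRepro.SevenThreeLineTable

/-!
# PercRepro — the `(7,3)` cell: the negative line cells have `k = 2` (p3, gen 16)

At `ℓ₀ = 3` the line table (`SevenThreeLineTable.lean`) only certifies `deltaN ≥ −53/4830·Lc`; the counting step of
Theorem P₁(7,3) (`P3-C025-seven-three-plan.md` §9 (R4)) also needs that a line through at most one point of `T`
(`k ≤ 1`) is never negative. This file `decide`s it: for `k ≤ 1` and every sorted class vector with `Σ cᵢ + 3 ≤ 5`,
`0 ≤ deltaN k 3 cs` (`lineNonneg`, 8 cells).
-/

namespace PercRepro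

namespace SevenThree

namespace LineTable

/-- The nonnegativity check at `ℓ₀ = 3` for a given `k`. -/
def LineNonneg (k : ℕ) : Prop :=
  ∀ c1 < 3, ∀ c2 < c1 + 1, ∀ c3 < c2 + 1, ∀ c4 < c3 + 1, ∀ c5 < c4 + 1,
    (!decide (c1 + c2 + c3 + c4 + c5 ≤ 2) || decide (0 ≤ deltaN k 3 [c1, c2, c3, c4, c5])) = true

/-- `LineNonneg` is decidable. -/
instance (k : ℕ) : Decidable (LineNonneg k) := by unfold LineNonneg; infer_instance

/-- `LineNonneg 0`. -/
theorem lineNonneg_0 : LineNonneg 0 := by unfold LineNonneg; decide +kernel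
/-- `LineNonneg 1`. -/
theorem lineNonneg_1 : LineNonneg 1 := by unfold LineNonneg; decide +kernel

/-- **Lines through at most one point of `T` are never negative at `ℓ₀ = 3`.** -/
theorem deltaN_nonneg_of_k_le_one {k c1 c2 c3 c4 c5 : ℕ} (hk : k ≤ 1) (h21 : c2 ≤ c1) (h32 : c3 ≤ c2) (h43 : c4 ≤ c3)
    (h54 : c5 ≤ c4) (hsum : c1 + c2 + c3 + c4 + c5 + 3 ≤ 5) : 0 ≤ deltaN k 3 [c1, c2, c3, c4, c5] := by
  have hc : LineNonneg k := by
    interval_cases k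
    · exact lineNonneg_0
    · exact lineNonneg_1
  have := hc c1 (by omega) c2 (by omega) c3 (by omega) c4 (by omega) c5 (by omega)
  rw [Bool.or_eq_true, Bool.not_eq_true', decide_eq_false_iff_not, decide_eq_true_eq] at this
  rcases this with h | h
  · exact absurd (by omega) h
  · exact h

end LineTable

end SevenThree

end PercRepro
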